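import Literature.NumberTheory.Automorphic.ArchRankOneSplitOrbitChart                -- ★ FILE 1 (p850131): `T`, `N`, `B` of `U(Φ₂)(ℂ)`, the Iwasawa form of invariant measures on `G ⧸ T`
import Literature.NumberTheory.Rogawski1990.ArchPlaneHaarHSBallLocal                  -- ★ `archPlaneLiftGL` (the lift `S¹ × SL₂(ℝ) → GL₂(ℂ)`), brings ★ `ArchPlaneSL2Model`, ★ `SL2IwasawaHaar`
import Mathlib.MeasureTheory.Integral.IntervalIntegral.Periodic                        -- `AddCircle (2π)`: `volume` is a Haar measure
import HarnessLib

/-!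
# The Iwasawa decomposition `U(Φ₂)(ℂ) = K₁ · B` with the CIRCLE `K₁ = {k_s = (cos s, −i sin s; −i sin s, cos s)}`, and the Haar measure of `K₁` as the image of `ds`

Topic `NumberTheory/Automorphic`; namespace `Literature.NumberTheory.Automorphic.UnitaryGroup`.  KERNEL mathematics only: theorems, no definition, no named fact,
no instance, no notation, no `sorry`.  Cell `pub/hodgecm-mathlib`, line LH3 (closer stub `stub_N9`, crux H413 = `stmt-HodgeConjecture-24833`), DIRECT ROAD brick
**(A0)-U11 GROUP HALF, (IWA)**: the structural input `hKB : ∀ g, ∃ k ∈ K, ∃ b ∈ B, g = k b` of ★ FILE 1 `exists_measure_quotient_torusU_complex_two_eq_smul_map`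
(Gelbart's `K T N` integration on `U(Φ₂)(ℂ) ⧸ T`) for the SMALLEST admissible compact `K`, and the Haar measure of that `K` in coordinates — the input of the
(A0-c) cone matching (FILE `ArchRankOneSplitConeMatching`).

THE MATHEMATICS.  `G = U(conj, J)(ℂ)`, `J = Φ₂ = antidiag(1,1)` (a VARIABLE with `hJ : J = (StdForm.antidiagonal 2).over ℂ`).  By ★ `exists_archPlaneLift_eq_of_unitary`
every `g ∈ G` is `z · D r D⁻¹` with `|z| = 1`, `r ∈ SL₂(ℝ)`, `D = diag(1, i)` (★ `archPlaneLift`), and by the Iwasawa decomposition of `SL₂(ℝ)` (★ `eq_iwasawa`: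
`r⁻¹ = s(w) k(φ)`) `r = k(−φ) s(w)⁻¹` with `s(w)⁻¹` upper triangular.  Hence **`g = k_{−φ} · b`** with `k_s = D k(s) D⁻¹ = archPlaneLift 1 (rotMat s) =
(cos s, −i sin s; −i sin s, cos s) ∈ G` and `b = z · D s(w)⁻¹ D⁻¹` upper triangular, i.e. `b ∈ B = borelU` (§2 `exists_rotLift_mul_mem_borelU`): `G = K₁ · B` for the
circle `K₁ = {k_s : s ∈ ℝ∕2πℤ}` — the scalars `S¹ · 1` of the maximal compact `S¹ · K₁` already lie in `T ⊂ B`.  §1: `s ↦ k_s` is a continuous homomorphism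
`ℝ∕2πℤ → G` (★ `rotMat_add`, ★ `archPlaneLift_mul`) conjugating the unipotent `[[1, y], [0, 1]]` to `1 + y · (i sin s cos s, cos² s; sin² s, −i sin s cos s)` (§1
`coe_rotLift_mul_unipotent_mul_inv`).  §3: the range `K₁` is compact, and for any subgroup `K` of `G` with carrier `K₁` the image of Lebesgue measure `ds` of
`ℝ∕2πℤ` under `s ↦ k_s` is a HAAR MEASURE of `K` (left invariance from `k_{s₀} k_s = k_{s₀+s}` and translation invariance of `ds`; finite; positive on opens since
`s ↦ k_s` is continuous onto `K`) — so `∫_K φ dκ = ∫_{ℝ∕2πℤ} φ(k_s) ds` for this `κ`.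
HONEST LABEL: HC_CM is proved only modulo the 7 printed citations (2 remaining: hLiu418 = stmt-HodgeConjecture-24832, h413 = stmt-HodgeConjecture-24833) until rung 0 closes;
structure theory over Mathlib + ★ kit, count-neutral, pays nothing by itself.

## References
* [Rogawski1990] J. D. Rogawski, *Automorphic Representations of Unitary Groups in Three Variables*, Ann. of Math. Stud. 123 (1990), §3.1 p. 19 (`U(1,1)`), §1.10 p. 9.
* [Borel1997] A. Borel, *Automorphic Forms on SL₂(ℝ)*, Cambridge Tracts 130 (1997), §4.1 (1)–(3) (`SU(1,1) = D SL₂(ℝ) D⁻¹`), §2.5 (Iwasawa `G = KAN`).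
* [Gelbart1975] S. Gelbart, *Automorphic Forms on Adele Groups*, Ann. of Math. Stud. 83, Thm. 9.22 (iii) (the `K T N` integration formula).
  (Cf. S. Lang, *SL₂(ℝ)*, GTM 105, Ch. III §1: Iwasawa decomposition and Haar measure in Iwasawa coordinates.) -/

set_option autoImplicit false

noncomputable section

open MeasureTheory Measure Set Filter Topology
open scoped ENNReal NNReal ComplexConjugate Real MatrixGroups Matrix

namespace Literature.NumberTheory.Automorphic

namespace UnitaryGroup

open Literature.NumberTheory.Rogawski1990 Literature.MeasureTheory.Group
open Literature.NumberTheory.Automorphic.UnitaryGroup.LineRing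

section RotLift

variable {J : Matrix (Fin 2) (Fin 2) ℂ} (hJ : J = (StdForm.antidiagonal 2).over ℂ)

/-! ## §1 The circle `s ↦ k_s = archPlaneLift 1 (rotMat s)` in `U(Φ₂)(ℂ)` -/

/-- The matrix of `k_s`: `archPlaneLift 1 (rotMat s) = (cos s, −i sin s; −i sin s, cos s)`. [cite: Borel1997, §4.1 (1)–(3)] -/
theorem archPlaneLift_one_rotMat (s : AddCircle (2 * π)) :
    archPlaneLift 1 (rotMat s) = !![((Real.Angle.cos s : ℝ) : ℂ), -Complex.I * ((Real.Angle.sin s : ℝ) : ℂ);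
      -Complex.I * ((Real.Angle.sin s : ℝ) : ℂ), ((Real.Angle.cos s : ℝ) : ℂ)] := by
  ext i j
  fin_cases i <;> fin_cases j <;> simp [archPlaneLift, rotMat]

/-- The matrix of `archPlaneLiftGL z r hr` is `archPlaneLift z r` (definitional). [cite: Borel1997, §4.1 (1)–(3)] -/
theorem val_archPlaneLiftGL (z : Circle) (r : Matrix (Fin 2) (Fin 2) ℝ) (hr : r.det = 1) :
    ((archPlaneLiftGL z r hr : GL (Fin 2) ℂ) : Matrix (Fin 2) (Fin 2) ℂ) = archPlaneLift (z : ℂ) r := rfl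

include hJ in
/-- **`k_s ∈ U(Φ₂)(ℂ)`** (★ `archPlaneLift_unitary`: `|1| = 1`, `det k(s) = 1`). [cite: Rogawski1990, §3.1 p. 19] [cite: Borel1997, §4.1 (1)–(3)] -/
theorem archPlaneLiftGL_rotMat_mem (s : AddCircle (2 * π)) : archPlaneLiftGL 1 (rotMat s) (det_rotMat s) ∈ unitaryGroupOfForm (starRingEnd ℂ) J := by
  rw [mem_unitaryGroupOfForm_iff, hJ, StdForm.over_antidiagonal_eq]
  exact archPlaneLift_unitary (by simp) (det_rotMat s)

/-- `s ↦ k_s` is a homomorphism: `k_{s+t} = k_s k_t` (★ `rotMat_add`, ★ `archPlaneLift_mul`). [cite: Borel1997, §4.1 (1)–(3)] -/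
theorem archPlaneLiftGL_rotMat_add (s t : AddCircle (2 * π)) :
    archPlaneLiftGL 1 (rotMat (s + t)) (det_rotMat (s + t)) = archPlaneLiftGL 1 (rotMat s) (det_rotMat s) * archPlaneLiftGL 1 (rotMat t) (det_rotMat t) := by
  refine Units.ext ?_
  rw [Units.val_mul, val_archPlaneLiftGL, val_archPlaneLiftGL, val_archPlaneLiftGL, rotMat_add, ← archPlaneLift_mul, Circle.coe_one, one_mul]

/-- `k_0 = 1`. [cite: Borel1997, §4.1 (1)–(3)] -/
theorem archPlaneLiftGL_rotMat_zero : archPlaneLiftGL 1 (rotMat 0) (det_rotMat 0) = 1 := by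
  refine Units.ext ?_
  rw [val_archPlaneLiftGL, Units.val_one, rotMat_zero, Circle.coe_one, archPlaneLift_one]

/-- `k_{−s} = k_s⁻¹`. [cite: Borel1997, §4.1 (1)–(3)] -/
theorem archPlaneLiftGL_rotMat_neg (s : AddCircle (2 * π)) :
    archPlaneLiftGL 1 (rotMat (-s)) (det_rotMat (-s)) = (archPlaneLiftGL 1 (rotMat s) (det_rotMat s))⁻¹ := by
  symm
  apply inv_eq_of_mul_eq_one_right
  rw [← archPlaneLiftGL_rotMat_add]
  have h : ∀ (u : AddCircle (2 * π)) (hu : u = 0), archPlaneLiftGL 1 (rotMat u) (det_rotMat u) = 1 := by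
    rintro u rfl; exact archPlaneLiftGL_rotMat_zero
  exact h _ (add_neg_cancel s)

/-- `s ↦ k_s` is continuous into `GL₂(ℂ)` (the matrix and its inverse `archPlaneLift 1 (adj k(s))` depend continuously on `s`). [cite: Borel1997, §4.1 (1)–(3)] -/
theorem continuous_archPlaneLiftGL_rotMat : Continuous fun s : AddCircle (2 * π) => archPlaneLiftGL 1 (rotMat s) (det_rotMat s) := by
  refine Units.continuous_iff.2 ⟨?_, ?_⟩
  · exact continuous_archPlaneLift_uncurry'.comp (continuous_const.prodMk continuous_rotMat)
  · exact continuous_archPlaneLift_uncurry'.comp (continuous_const.prodMk (continuous_rotMat.matrix_adjugate))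

include hJ in
/-- `s ↦ k_s` is continuous into `U(Φ₂)(ℂ)`. [cite: Borel1997, §4.1 (1)–(3)] -/
theorem continuous_rotLift :
    Continuous fun s : AddCircle (2 * π) => (⟨archPlaneLiftGL 1 (rotMat s) (det_rotMat s), archPlaneLiftGL_rotMat_mem hJ s⟩ : ↥(unitaryGroupOfForm (starRingEnd ℂ) J)) :=
  continuous_archPlaneLiftGL_rotMat.subtype_mk _

include hJ in
/-- **`k_s [[1, y], [0, 1]] k_s⁻¹ = 1 + y · (i sin s cos s, cos² s; sin² s, −i sin s cos s)`** for `u = [[1, y], [0, 1]] ∈ N` (`y = u₀₁`; ★ `umat_shape_two`): the conjugate of a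
unipotent by the circle is a point of the (`K₁`-saturated) unipotent cone. [cite: Rogawski1990, §3.1 p. 19] -/
theorem coe_rotLift_mul_unipotent_mul_inv (s : AddCircle (2 * π)) (u : ↥(unipotentU (starRingEnd ℂ) J)) :
    ((((⟨archPlaneLiftGL 1 (rotMat s) (det_rotMat s), archPlaneLiftGL_rotMat_mem hJ s⟩ : ↥(unitaryGroupOfForm (starRingEnd ℂ) J)) *
          (u : ↥(unitaryGroupOfForm (starRingEnd ℂ) J)) *
          (⟨archPlaneLiftGL 1 (rotMat s) (det_rotMat s), archPlaneLiftGL_rotMat_mem hJ s⟩ : ↥(unitaryGroupOfForm (starRingEnd ℂ) J))⁻¹ :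
        ↥(unitaryGroupOfForm (starRingEnd ℂ) J)) : GL (Fin 2) ℂ) : Matrix (Fin 2) (Fin 2) ℂ) =
      1 + (((u : ↥(unitaryGroupOfForm (starRingEnd ℂ) J)) : GL (Fin 2) ℂ) : Matrix (Fin 2) (Fin 2) ℂ) 0 1 •
        !![Complex.I * ((Real.Angle.sin s : ℝ) : ℂ) * ((Real.Angle.cos s : ℝ) : ℂ), ((Real.Angle.cos s : ℝ) : ℂ) ^ 2;
           ((Real.Angle.sin s : ℝ) : ℂ) ^ 2, -(Complex.I * ((Real.Angle.sin s : ℝ) : ℂ) * ((Real.Angle.cos s : ℝ) : ℂ))] := by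
  obtain ⟨h10, h00, h11⟩ := umat_shape_two (starRingEnd ℂ) u
  set y := (((u : ↥(unitaryGroupOfForm (starRingEnd ℂ) J)) : GL (Fin 2) ℂ) : Matrix (Fin 2) (Fin 2) ℂ) 0 1 with hy
  have hu : (((u : ↥(unitaryGroupOfForm (starRingEnd ℂ) J)) : GL (Fin 2) ℂ) : Matrix (Fin 2) (Fin 2) ℂ) = !![1, y; 0, 1] := by
    ext i j; fin_cases i <;> fin_cases j
    · exact h00
    · rfl
    · exact h10
    · exact h11
  have htrig : ((Real.Angle.cos s : ℝ) : ℂ) ^ 2 + ((Real.Angle.sin s : ℝ) : ℂ) ^ 2 = 1 := by exact_mod_cast cosA_sq_add_sinA_sq s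
  have hc : Real.Angle.cos (-s) = Real.Angle.cos s := Real.Angle.cos_neg s
  have hs : Real.Angle.sin (-s) = -Real.Angle.sin s := Real.Angle.sin_neg s
  rw [Subgroup.coe_mul, Subgroup.coe_mul, Subgroup.coe_inv, Units.val_mul, Units.val_mul, ← archPlaneLiftGL_rotMat_neg, val_archPlaneLiftGL,
    val_archPlaneLiftGL, hu, Circle.coe_one, archPlaneLift_one_rotMat, archPlaneLift_one_rotMat, hc, hs]
  ext i j
  fin_cases i <;> fin_cases j
  · simp [Matrix.mul_apply, Fin.sum_univ_two]
    linear_combination htrig + (-((Real.Angle.sin s : ℝ) : ℂ) ^ 2) * Complex.I_sq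
  · simp [Matrix.mul_apply, Fin.sum_univ_two]
    ring
  · simp [Matrix.mul_apply, Fin.sum_univ_two]
    linear_combination (-(((Real.Angle.sin s : ℝ) : ℂ) ^ 2 * y)) * Complex.I_sq
  · simp [Matrix.mul_apply, Fin.sum_univ_two]
    linear_combination htrig + (-((Real.Angle.sin s : ℝ) : ℂ) ^ 2) * Complex.I_sq

/-! ## §2 The Iwasawa decomposition `U(Φ₂)(ℂ) = K₁ · B` -/

include hJ in
/-- **IWASAWA DECOMPOSITION OF `U(Φ₂)(ℂ)` along the circle `K₁`**: every `g ∈ U(Φ₂)(ℂ)` is `k_s · b` with `b` upper triangular (`b ∈ B = borelU`): `g = z · D r D⁻¹`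
(★ `exists_archPlaneLift_eq_of_unitary`), `r⁻¹ = s(w) k(φ)` in `SL₂(ℝ)` (★ `eq_iwasawa`), so `g = k_{−φ} · (z · D s(w)⁻¹ D⁻¹)`.  This is the `hKB` binder of ★ FILE 1.
[cite: Borel1997, §2.5, §4.1] [cite: Rogawski1990, §3.1 p. 19] -/
theorem exists_rotLift_mul_mem_borelU (g : ↥(unitaryGroupOfForm (starRingEnd ℂ) J)) :
    ∃ s : AddCircle (2 * π), ∃ b ∈ borelU (starRingEnd ℂ) J,
      g = (⟨archPlaneLiftGL 1 (rotMat s) (det_rotMat s), archPlaneLiftGL_rotMat_mem hJ s⟩ : ↥(unitaryGroupOfForm (starRingEnd ℂ) J)) * b := by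
  have hy : (Matrix.map ((g : GL (Fin 2) ℂ) : Matrix (Fin 2) (Fin 2) ℂ) (starRingEnd ℂ))ᵀ *
      (Matrix.of fun i j : Fin 2 => if i.val + j.val + 1 = 2 then (1 : ℂ) else 0) * ((g : GL (Fin 2) ℂ) : Matrix (Fin 2) (Fin 2) ℂ) =
      (Matrix.of fun i j : Fin 2 => if i.val + j.val + 1 = 2 then (1 : ℂ) else 0) := by
    have h2 : (g : GL (Fin 2) ℂ) ∈ unitaryGroupOfForm (starRingEnd ℂ) (Matrix.of fun i j : Fin 2 => if i.val + j.val + 1 = 2 then (1 : ℂ) else 0) := by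
      rw [← StdForm.over_antidiagonal_eq, ← hJ]; exact g.2
    exact h2
  obtain ⟨z, r, hz, hr, hg⟩ := exists_archPlaneLift_eq_of_unitary hy
  -- Iwasawa for `r⁻¹ ∈ SL₂(ℝ)`
  set R : SL(2, ℝ) := ⟨r, hr⟩ with hR
  set w : UpperHalfPlane := R⁻¹ • UpperHalfPlane.I with hw
  set φ : AddCircle (2 * π) := angleOf ((R⁻¹ : SL(2, ℝ)) : Matrix (Fin 2) (Fin 2) ℝ) with hφ
  have hiw : r.adjugate = sMat w * rotMat φ := by
    have h := eq_iwasawa R⁻¹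
    rw [Matrix.SpecialLinearGroup.coe_inv] at h
    exact h
  have h1 : sMat w * rotMat φ * r = 1 := by
    rw [← hiw, Matrix.adjugate_mul, hr, one_smul]
  have hrot : rotMat φ * r = (sMat w).adjugate := by
    have hS : (sMat w).adjugate * sMat w = 1 := by rw [Matrix.adjugate_mul, det_sMat, one_smul]
    calc rotMat φ * r = (sMat w).adjugate * sMat w * (rotMat φ * r) := by rw [hS, Matrix.one_mul]
      _ = (sMat w).adjugate * (sMat w * rotMat φ * r) := by simp only [Matrix.mul_assoc]
      _ = (sMat w).adjugate := by rw [h1, Matrix.mul_one]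
  -- the circle factor `k_{−φ}` and the Borel factor `b = k_φ g`
  set k : ↥(unitaryGroupOfForm (starRingEnd ℂ) J) := ⟨archPlaneLiftGL 1 (rotMat (-φ)) (det_rotMat (-φ)), archPlaneLiftGL_rotMat_mem hJ (-φ)⟩ with hk
  refine ⟨-φ, k⁻¹ * g, ?_, by rw [mul_inv_cancel_left]⟩
  have hkinv : (((k⁻¹ : ↥(unitaryGroupOfForm (starRingEnd ℂ) J)) : GL (Fin 2) ℂ) : Matrix (Fin 2) (Fin 2) ℂ) = archPlaneLift 1 (rotMat φ) := by
    rw [Subgroup.coe_inv, hk, ← archPlaneLiftGL_rotMat_neg, neg_neg, val_archPlaneLiftGL, Circle.coe_one]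
  have hb : ((((k⁻¹ * g : ↥(unitaryGroupOfForm (starRingEnd ℂ) J))) : GL (Fin 2) ℂ) : Matrix (Fin 2) (Fin 2) ℂ) = archPlaneLift z (sMat w).adjugate := by
    rw [Subgroup.coe_mul, Units.val_mul, hkinv, hg, ← archPlaneLift_mul, one_mul, hrot]
  rw [mem_borelU_iff, hb]
  intro i j hij
  fin_cases i <;> fin_cases j <;> simp at hij
  simp [archPlaneLift, Matrix.adjugate_fin_two, sMat]

/-! ## §3 The range `K₁` is compact, and `ds` pushes forward to a Haar measure of `K₁` -/

include hJ in
/-- **`K₁ = {k_s}` is compact** (continuous image of `ℝ∕2πℤ`). [cite: Borel1997, §2.5] -/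
theorem isCompact_range_rotLift :
    IsCompact (Set.range fun s : AddCircle (2 * π) =>
      (⟨archPlaneLiftGL 1 (rotMat s) (det_rotMat s), archPlaneLiftGL_rotMat_mem hJ s⟩ : ↥(unitaryGroupOfForm (starRingEnd ℂ) J))) := by
  haveI : Fact (0 < 2 * π) := ⟨Real.two_pi_pos⟩
  exact isCompact_range (continuous_rotLift hJ)

include hJ in
/-- **THE HAAR MEASURE OF THE CIRCLE `K₁ ≤ U(Φ₂)(ℂ)` IN THE COORDINATE `s`**: for any subgroup `K` of `U(Φ₂)(ℂ)` whose elements are exactly the `k_s`, the image of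
Lebesgue measure `ds` of `ℝ∕2πℤ` under `s ↦ k_s` is a Haar measure of `K` (left invariance: `k_{s₀} k_s = k_{s₀+s}` and `ds` is translation invariant; finite; positive
on non-empty open sets, `s ↦ k_s` being continuous ONTO `K`).  Consequently `∫_K φ dκ = ∫_{ℝ∕2πℤ} φ(k_s) ds` for this `κ`. [cite: Borel1997, §2.5] [cite: Gelbart1975, Thm. 9.22 (iii)] -/
theorem isHaarMeasure_map_rotLift [Fact (0 < 2 * π)] [MeasurableSpace ↥(unitaryGroupOfForm (starRingEnd ℂ) J)] [BorelSpace ↥(unitaryGroupOfForm (starRingEnd ℂ) J)]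
    (K : Subgroup ↥(unitaryGroupOfForm (starRingEnd ℂ) J))
    (hK : ∀ s : AddCircle (2 * π),
      (⟨archPlaneLiftGL 1 (rotMat s) (det_rotMat s), archPlaneLiftGL_rotMat_mem hJ s⟩ : ↥(unitaryGroupOfForm (starRingEnd ℂ) J)) ∈ K)
    (hK' : ∀ k ∈ K, ∃ s : AddCircle (2 * π),
      k = (⟨archPlaneLiftGL 1 (rotMat s) (det_rotMat s), archPlaneLiftGL_rotMat_mem hJ s⟩ : ↥(unitaryGroupOfForm (starRingEnd ℂ) J))) :
    IsHaarMeasure (Measure.map (fun s : AddCircle (2 * π) =>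
      (⟨⟨archPlaneLiftGL 1 (rotMat s) (det_rotMat s), archPlaneLiftGL_rotMat_mem hJ s⟩, hK s⟩ : ↥K)) (volume : Measure (AddCircle (2 * π)))) := by
  haveI : BorelSpace ↥K := Subtype.borelSpace _
  set ι : AddCircle (2 * π) → ↥K := fun s => ⟨⟨archPlaneLiftGL 1 (rotMat s) (det_rotMat s), archPlaneLiftGL_rotMat_mem hJ s⟩, hK s⟩ with hι
  have hιc : Continuous ι := (continuous_rotLift hJ).subtype_mk _
  have hιm : Measurable ι := hιc.measurable
  have hι_add : ∀ s t, ι (s + t) = ι s * ι t := fun s t => Subtype.ext (Subtype.ext (archPlaneLiftGL_rotMat_add s t))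
  have hι_surj : Function.Surjective ι := by
    intro k
    obtain ⟨s, hs⟩ := hK' (k : ↥(unitaryGroupOfForm (starRingEnd ℂ) J)) k.2
    exact ⟨s, Subtype.ext hs.symm⟩
  refine { toIsMulLeftInvariant := ⟨fun k => ?_⟩, lt_top_of_isCompact := fun C _ => measure_lt_top _ _, toIsOpenPosMeasure := ⟨fun U hU hne => ?_⟩ }
  · obtain ⟨s₀, rfl⟩ := hι_surj k
    rw [Measure.map_map (measurable_const_mul _) hιm]
    have hcomp : (fun x : ↥K => ι s₀ * x) ∘ ι = ι ∘ fun s => s₀ + s := by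
      funext s; simp only [Function.comp_apply, hι_add]
    rw [hcomp, ← Measure.map_map hιm (measurable_const_add s₀), map_add_left_eq_self]
  · rw [Measure.map_apply hιm hU.measurableSet]
    obtain ⟨k, hk⟩ := hne
    obtain ⟨s, rfl⟩ := hι_surj k
    exact ((hU.preimage hιc).measure_pos volume ⟨s, hk⟩).ne'

end RotLift

end UnitaryGroup

end Literature.NumberTheory.Automorphic

end
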